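import Summits.KontsevichZagierPeriods.KontsevichZagierPeriods.Theorems.LiouvilleUnfoldingAyoubPiCancellationBandReduction

/-!
# Crux stmt-KontsevichZagierPeriods-0540 (`LiouvilleUnfolding.AyoubPiCancellation` ≡ `KZ.PiCancellation`),
# line `Sketch` (idea `moving-segment-wronskian`): stub `stub_slabFibredDescent` (side theorem)

Support file (`--supports` stmt-KontsevichZagierPeriods-0540) of the line skeleton, registered stub
`stub_slabFibredDescent` (S/M, side theorem) — **π-cancellation for SLAB-FIBRED certificates**, the
final form of the line's band-finishing method.

Fix an interior slab `{a < z₀ < b}` (`-1 < a < b < 1`, `a b` rational) and a pinned disc family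
`P n r = [{z : ℝⁿ⁺² | z 0² + z 1² ≤ 1, tail z ∈ σ_r}, g_r ∘ tail]`. A **slab-fibred certificate**
of `[π]·c = lift (of ∘ P) c` is a chain of: domain/integrand additivity instances (all dimensions),
Newton–Leibniz moves over bases of dimension `≥ 1` (`KZ.fibredNewtonLeibnizRel`), and rule-(2)
substitutions `Φ` on `(n+1)`-dimensional domains which FIX `z₀` at every point that starts OR lands
in the slab — `(a < x 0 < b ∨ a < Φ x 0 < b) → Φ x 0 = x 0` — and are otherwise arbitrary (they may
move `z₀` freely outside the slab, and even jump over it). If `[π]·c` has a slab-fibred certificate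
then `c ∈ relations`.

Proof. (1) `slabFibred_of_slabRestrict_mem_fibredChangeOfVariablesRel`: the slab restriction of a
slab-fibred substitution is a `z₀`-FIBRED substitution between the slab restrictions — the clause
gives `Φ '' (σ ∩ slab) = Φ '' σ ∩ slab` (a point of `σ ∩ slab` is fixed in `z₀` by the left
disjunct; a point of `σ` landing in the slab is fixed in `z₀` by the right disjunct) and
`Φ x 0 = x 0` on `σ ∩ slab`. (2) `slabMap_mem_fibredRelations_of_slabFibred`: hence the slab
restriction `KZ.slabMap a b` maps the slab-fibred closure into `KZ.fibredRelations`
(`AddSubgroup.closure_le` + `comap`; additivity and fibred Newton–Leibniz restrict by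
`KZ.of_slabRestrict_mem_domainAddRel`, `KZ.of_slabRestrict_mem_integrandAddRel`,
`KZ.of_slabRestrict_mem_newtonLeibnizRel`, constants restrict to `0`). (3) The slab restriction of
the disc certificate is the certificate of the pinned BAND family `B n r = (P n r).slabRestrict a b`
(`slabRestrict_isBand`, `lift_band_eq_slabMap_lift`), which is therefore `z₀`-fibred, and band
finishing `stub_bandFinishing` ((A2) of the line) gives `c ∈ relations`.
Corollary `ayoubPiCancellation_iff_slabFibredReduction`: item 0540 ⟺ every certificate of `[π]·c`
can be traded for a slab-fibred one ((→) by `BetaCancellationLine.stub_piMulFibred`, a fibred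
substitution being slab-fibred; (←) by the stub).
No definitions; sorry-free; axioms ⊆ {propext, Classical.choice, Quot.sound}.

References: M. Kontsevich, D. Zagier, *Periods* (2001), §1.2 (rules (1)–(3)), §4.1; J. Ayoub,
*Une version relative de la conjecture des périodes de Kontsevich–Zagier*, Ann. of Math. 181
(2015), §1.
-/

noncomputable section

-- `Summit.KontsevichZagierPeriods.KontsevichZagierPeriods.…` is the tree's mandated layout (single-conjunct summit).
set_option linter.dupNamespace false

namespace Summit.KontsevichZagierPeriods.KontsevichZagierPeriods.AyoubPiCancellationLine

open Set MeasureTheory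
open Literature.NumberTheory.Transcendental
open Literature.NumberTheory.Transcendental.KZ
open Summit.KontsevichZagierPeriods.KontsevichZagierPeriods.BetaCancellationLine (stub_piMulFibred)

/-! ### Slab restriction of a slab-fibred substitution -/

-- adapted from Literature/NumberTheory/Transcendental/KZFibredRelations.lean
-- (`of_slabRestrict_mem_fibredChangeOfVariablesRel`, with the clause `Φ x 0 = x 0` weakened to the
-- points starting or landing in the slab)

/-- **Slab restriction of a slab-fibred change of variables is a fibred change of variables**: if
the substitution `Φ` fixes `z 0` at every point of `r.domain` that starts or lands in the slab
`{a < z 0 < b}`, then it maps `r.domain ∩ slab` onto `r'.domain ∩ slab` and preserves `z 0` there;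
all other clauses of rule (2) restrict. [cite: KontsevichZagier2001, §1.2 rule (2)] -/
theorem slabFibred_of_slabRestrict_mem_fibredChangeOfVariablesRel {n : ℕ} {r r' : IntegralRep (n + 1)}
    {Φ : (Fin (n + 1) → ℝ) → (Fin (n + 1) → ℝ)}
    {Φ' : (Fin (n + 1) → ℝ) → (Fin (n + 1) → ℝ) →L[ℝ] (Fin (n + 1) → ℝ)}
    (hΦ : IsSemialgebraicMapOn ℚ r.domain Φ)
    (hΦ' : ∀ x ∈ r.domain, HasFDerivWithinAt Φ (Φ' x) r.domain x) (hinj : InjOn Φ r.domain)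
    (hdom : r'.domain = Φ '' r.domain)
    (hf : ∀ x ∈ r.domain, r.integrand x = r'.integrand (Φ x) * |(Φ' x).det|) (a b : ℚ)
    (h0 : ∀ x ∈ r.domain,
      (((a : ℝ) < x 0 ∧ x 0 < b) ∨ ((a : ℝ) < Φ x 0 ∧ Φ x 0 < b)) → Φ x 0 = x 0) :
    of (r.slabRestrict a b) - of (r'.slabRestrict a b) ∈ fibredChangeOfVariablesRel := by
  refine ⟨n, r.slabRestrict a b, r'.slabRestrict a b, Φ, Φ',
    hΦ.mono inter_subset_left (r.slabRestrict a b).isSemialgebraic_domain,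
    fun x hx => (hΦ' x hx.1).mono inter_subset_left, hinj.mono inter_subset_left, ?_,
    fun x hx => hf x hx.1, fun x hx => h0 x hx.1 (Or.inl hx.2), rfl⟩
  ext y
  simp only [IntegralRep.domain_slabRestrict, mem_inter_iff, mem_image, mem_paramSlab]
  constructor
  · rintro ⟨hy, hya, hyb⟩
    rw [hdom] at hy
    obtain ⟨x, hx, rfl⟩ := hy
    have hx0 : Φ x 0 = x 0 := h0 x hx (Or.inr ⟨hya, hyb⟩)
    rw [hx0] at hya hyb
    exact ⟨x, ⟨hx, hya, hyb⟩, rfl⟩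
  · rintro ⟨x, ⟨hx, hxa, hxb⟩, rfl⟩
    rw [h0 x hx (Or.inl ⟨hxa, hxb⟩), hdom]
    exact ⟨mem_image_of_mem Φ hx, hxa, hxb⟩

/-! ### Slab restriction of a slab-fibred certificate is a fibred certificate -/

-- adapted from Literature/NumberTheory/Transcendental/KZFibredRelations.lean
-- (`slabMap_mem_fibredRelations`: closure bookkeeping, the third case replaced by
-- `slabFibred_of_slabRestrict_mem_fibredChangeOfVariablesRel`)

/-- **Slab restriction maps slab-fibred certificates to `z₀`-fibred relations**: `KZ.slabMap a b`
sends the closure of {additivity, slab-fibred substitutions, Newton–Leibniz over bases of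
dimension `≥ 1`} into `KZ.fibredRelations` — generatorwise (`AddSubgroup.closure_le`, `comap`):
additivity and fibred Newton–Leibniz restrict (`KZ.of_slabRestrict_mem_domainAddRel`,
`KZ.of_slabRestrict_mem_integrandAddRel`, `KZ.of_slabRestrict_mem_newtonLeibnizRel`; constants go
to `0`), and a slab-fibred substitution restricts to a fibred one
(`slabFibred_of_slabRestrict_mem_fibredChangeOfVariablesRel`). [cite: KontsevichZagier2001, §1.2 rule (2)] -/
theorem slabMap_mem_fibredRelations_of_slabFibred (a b : ℚ) {c : FormalRep}
    (hc : c ∈ AddSubgroup.closure (domainAddRel ∪ integrandAddRel ∪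
      {x | ∃ (n : ℕ) (r r' : IntegralRep (n + 1)) (Φ : (Fin (n + 1) → ℝ) → (Fin (n + 1) → ℝ))
          (Φ' : (Fin (n + 1) → ℝ) → (Fin (n + 1) → ℝ) →L[ℝ] (Fin (n + 1) → ℝ)),
        IsSemialgebraicMapOn ℚ r.domain Φ ∧
        (∀ x ∈ r.domain, HasFDerivWithinAt Φ (Φ' x) r.domain x) ∧ Set.InjOn Φ r.domain ∧
        r'.domain = Φ '' r.domain ∧
        (∀ x ∈ r.domain, r.integrand x = r'.integrand (Φ x) * |(Φ' x).det|) ∧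
        (∀ x ∈ r.domain, (((a : ℝ) < x 0 ∧ x 0 < b) ∨ ((a : ℝ) < Φ x 0 ∧ Φ x 0 < b)) → Φ x 0 = x 0) ∧
        x = of r - of r'} ∪
      fibredNewtonLeibnizRel)) :
    slabMap a b c ∈ fibredRelations := by
  refine (AddSubgroup.closure_le (fibredRelations.comap (slabMap a b))).mpr ?_ hc
  rintro c (((hc | hc) | hc) | hc)
  · obtain ⟨k, r, r₁, r₂, hdom, hnull, h₁, h₂, rfl⟩ := hc
    rw [AddSubgroup.coe_comap, mem_preimage, map_sub, map_sub]
    cases k with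
    | zero => simp
    | succ k =>
      rw [slabMap_of, slabMap_of, slabMap_of]
      exact mem_fibredRelations_of_mem_domainAddRel (of_slabRestrict_mem_domainAddRel hdom hnull h₁ h₂ a b)
  · obtain ⟨k, r, r₁, r₂, h₁, h₂, hadd, rfl⟩ := hc
    rw [AddSubgroup.coe_comap, mem_preimage, map_sub, map_sub]
    cases k with
    | zero => simp
    | succ k =>
      rw [slabMap_of, slabMap_of, slabMap_of]
      exact mem_fibredRelations_of_mem_integrandAddRel
        (of_slabRestrict_mem_integrandAddRel h₁ h₂ hadd a b)
  · obtain ⟨k, r, r', Φ, Φ', hΦ, hΦ', hinj, hdom, hf, h0, rfl⟩ := hc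
    rw [AddSubgroup.coe_comap, mem_preimage, map_sub, slabMap_of, slabMap_of]
    exact mem_fibredRelations_of_mem_fibredChangeOfVariablesRel
      (slabFibred_of_slabRestrict_mem_fibredChangeOfVariablesRel hΦ hΦ' hinj hdom hf a b h0)
  · obtain ⟨k, r, r', α, β, F, hF, hα, hβ, hle, hband, hcont, hderiv, hr', rfl⟩ :=
      mem_fibredNewtonLeibnizRel_iff.mp hc
    rw [AddSubgroup.coe_comap, mem_preimage, map_sub, slabMap_of, slabMap_of]
    exact mem_fibredRelations_of_mem_fibredNewtonLeibnizRel (of_sub_of_mem_fibredNewtonLeibnizRel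
      (of_slabRestrict_mem_newtonLeibnizRel hF hα hβ hle hband hcont hderiv hr' a b))

/-! ### The stub -/

/-- **STUB `stub_slabFibredDescent`** (S/M, side theorem — the FINAL FORM of the band-finishing
method) of the line `Sketch`: **π-cancellation for SLAB-FIBRED certificates.** Fix an interior slab
`{a < z₀ < b}`. If a certificate of `[π]·c` uses additivity, Newton–Leibniz over bases of dimension
`≥ 1`, and rule-(2) substitutions that FIX `z₀` at every point which starts or lands in the slab
(and are otherwise arbitrary), then `c ∈ relations`: the slab restriction `KZ.slabMap a b` sends
every such generator to a `z₀`-FIBRED generator (`slabMap_mem_fibredRelations_of_slabFibred`) and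
the disc family to the band family (`slabRestrict_isBand`, `lift_band_eq_slabMap_lift`), and the
band finishes (`stub_bandFinishing`). [folklore] -/
theorem stub_slabFibredDescent : ∀ (a b : ℚ), -1 < a → a < b → b < 1 →
    ∀ (P : ∀ n : ℕ, IntegralRep n → IntegralRep (n + 2)),
      (∀ (n : ℕ) (r : IntegralRep n),
        (P n r).domain = {z : Fin (n + 2) → ℝ | z 0 ^ 2 + z 1 ^ 2 ≤ 1 ∧
          (fun i : Fin n => z i.succ.succ) ∈ r.domain} ∧
        (P n r).integrand = fun z => r.integrand (fun i : Fin n => z i.succ.succ)) →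
      ∀ (c : FormalRep),
        FreeAbelianGroup.lift (fun s : (Σ n, IntegralRep n) => of (P s.1 s.2)) c ∈
          AddSubgroup.closure (domainAddRel ∪ integrandAddRel ∪
          {x | ∃ (n : ℕ) (r r' : IntegralRep (n + 1)) (Φ : (Fin (n + 1) → ℝ) → (Fin (n + 1) → ℝ))
              (Φ' : (Fin (n + 1) → ℝ) → (Fin (n + 1) → ℝ) →L[ℝ] (Fin (n + 1) → ℝ)),
            IsSemialgebraicMapOn ℚ r.domain Φ ∧
            (∀ x ∈ r.domain, HasFDerivWithinAt Φ (Φ' x) r.domain x) ∧ Set.InjOn Φ r.domain ∧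
            r'.domain = Φ '' r.domain ∧
            (∀ x ∈ r.domain, r.integrand x = r'.integrand (Φ x) * |(Φ' x).det|) ∧
            (∀ x ∈ r.domain, (((a : ℝ) < x 0 ∧ x 0 < b) ∨ ((a : ℝ) < Φ x 0 ∧ Φ x 0 < b)) → Φ x 0 = x 0) ∧
            x = of r - of r'} ∪
          fibredNewtonLeibnizRel) →
        c ∈ relations := by
  intro a b ha hab hb P hP c hc
  -- the pinned band family `B n r = (P n r).slabRestrict a b`
  have hB := slabRestrict_isBand a b P hP
  -- its certificate is the slab restriction of the disc certificate, hence `z₀`-fibred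
  have key := lift_band_eq_slabMap_lift a b P hP (fun n r => (P n r).slabRestrict a b) hB c
  have hfib : FreeAbelianGroup.lift
      (fun s : (Σ n, IntegralRep n) => of ((fun n r => (P n r).slabRestrict a b) s.1 s.2)) c ∈
        fibredRelations := by
    rw [key]
    exact slabMap_mem_fibredRelations_of_slabFibred a b hc
  -- band finishing (A2)
  exact stub_bandFinishing a b ha hab hb (fun n r => (P n r).slabRestrict a b) hB c hfib

/-! ### Corollary: item 0540 ⟺ slab-fibred reduction -/

/-- **A `z₀`-fibred relation is a slab-fibred certificate** (for every slab): each fibred generator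
is a slab-fibred generator — a fibred substitution (`Φ x 0 = x 0` everywhere on the domain)
satisfies the slab clause trivially (`AddSubgroup.closure_mono`). [cite: KontsevichZagier2001, §1.2 rule (2)] -/
theorem fibredRelations_le_slabFibredClosure (a b : ℚ) :
    fibredRelations ≤ AddSubgroup.closure (domainAddRel ∪ integrandAddRel ∪
      {x | ∃ (n : ℕ) (r r' : IntegralRep (n + 1)) (Φ : (Fin (n + 1) → ℝ) → (Fin (n + 1) → ℝ))
          (Φ' : (Fin (n + 1) → ℝ) → (Fin (n + 1) → ℝ) →L[ℝ] (Fin (n + 1) → ℝ)),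
        IsSemialgebraicMapOn ℚ r.domain Φ ∧
        (∀ x ∈ r.domain, HasFDerivWithinAt Φ (Φ' x) r.domain x) ∧ Set.InjOn Φ r.domain ∧
        r'.domain = Φ '' r.domain ∧
        (∀ x ∈ r.domain, r.integrand x = r'.integrand (Φ x) * |(Φ' x).det|) ∧
        (∀ x ∈ r.domain, (((a : ℝ) < x 0 ∧ x 0 < b) ∨ ((a : ℝ) < Φ x 0 ∧ Φ x 0 < b)) → Φ x 0 = x 0) ∧
        x = of r - of r'} ∪
      fibredNewtonLeibnizRel) := by
  rw [fibredRelations_def]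
  refine AddSubgroup.closure_mono ?_
  rw [fibredGenerators_def]
  rintro y (((hy | hy) | hy) | hy)
  · exact Or.inl (Or.inl (Or.inl hy))
  · exact Or.inl (Or.inl (Or.inr hy))
  · obtain ⟨k, r, r', Φ, Φ', hΦ, hΦ', hinj, hdom, hf, h0, rfl⟩ := hy
    exact Or.inl (Or.inr ⟨k, r, r', Φ, Φ', hΦ, hΦ', hinj, hdom, hf, fun x hx _ => h0 x hx, rfl⟩)
  · exact Or.inr hy

-- adapted from Summits/KontsevichZagierPeriods/KontsevichZagierPeriods/Theorems/TerasomaMultiplicationBetaCancellationWeightDescent.lean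
-- (`ayoubPiCancellation_iff_weightReduction`, with the `w`-preserving class replaced by the
-- slab-fibred class and `weightDescent` by `stub_slabFibredDescent`)

/-- **Item 0540 ⟺ SLAB-FIBRED REDUCTION, for every interior slab `-1 < a < b < 1`**:
`AyoubPiCancellation` holds iff every certificate of `[π]·c` (`lift (of ∘ P) c ∈ relations`, `P` a
pinned disc family) can be traded for a slab-fibred one. (→): the crux gives `c ∈ relations`, the
disc certificate of a relation is `z₀`-fibred (`BetaCancellationLine.stub_piMulFibred`), and fibred
is slab-fibred (`fibredRelations_le_slabFibredClosure`). (←): `stub_slabFibredDescent`. [folklore] -/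
theorem ayoubPiCancellation_iff_slabFibredReduction (a b : ℚ) (ha : -1 < a) (hab : a < b)
    (hb : b < 1) :
    Summit.KontsevichZagierPeriods.KontsevichZagierPeriods.Theses.AyoubSpecialisation.AyoubPiCancellation ↔
    ∀ (P : ∀ n : ℕ, IntegralRep n → IntegralRep (n + 2)),
      (∀ (n : ℕ) (r : IntegralRep n),
        (P n r).domain = {z : Fin (n + 2) → ℝ | z 0 ^ 2 + z 1 ^ 2 ≤ 1 ∧
          (fun i : Fin n => z i.succ.succ) ∈ r.domain} ∧
        (P n r).integrand = fun z => r.integrand (fun i : Fin n => z i.succ.succ)) →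
      ∀ c : FormalRep,
        FreeAbelianGroup.lift (fun s : (Σ n, IntegralRep n) => of (P s.1 s.2)) c ∈ relations →
        FreeAbelianGroup.lift (fun s : (Σ n, IntegralRep n) => of (P s.1 s.2)) c ∈
          AddSubgroup.closure (domainAddRel ∪ integrandAddRel ∪
          {x | ∃ (n : ℕ) (r r' : IntegralRep (n + 1)) (Φ : (Fin (n + 1) → ℝ) → (Fin (n + 1) → ℝ))
              (Φ' : (Fin (n + 1) → ℝ) → (Fin (n + 1) → ℝ) →L[ℝ] (Fin (n + 1) → ℝ)),
            IsSemialgebraicMapOn ℚ r.domain Φ ∧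
            (∀ x ∈ r.domain, HasFDerivWithinAt Φ (Φ' x) r.domain x) ∧ Set.InjOn Φ r.domain ∧
            r'.domain = Φ '' r.domain ∧
            (∀ x ∈ r.domain, r.integrand x = r'.integrand (Φ x) * |(Φ' x).det|) ∧
            (∀ x ∈ r.domain, (((a : ℝ) < x 0 ∧ x 0 < b) ∨ ((a : ℝ) < Φ x 0 ∧ Φ x 0 < b)) → Φ x 0 = x 0) ∧
            x = of r - of r'} ∪
          fibredNewtonLeibnizRel) := by
  constructor
  · -- (→): `c ∈ relations`, the disc certificate is fibred, and fibred is slab-fibred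
    intro h P hP c hc
    exact fibredRelations_le_slabFibredClosure a b (stub_piMulFibred P hP c (h P hP c hc))
  · -- (←): slab-fibred descent
    intro h P hP c hc
    exact stub_slabFibredDescent a b ha hab hb P hP c (h P hP c hc)

end Summit.KontsevichZagierPeriods.KontsevichZagierPeriods.AyoubPiCancellationLine
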